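import Summits.Parity.GeneralizedHardyLittlewood.Theses.ClassVarianceLadder

/-!
# StrategyCensus.lean — typed signatures for STRATEGY-CENSUS.md on the crux `MobiusCofactorAtom`
(item stmt-Parity-13833, route-Parity-ClassVarianceLadder; strategist planner-cstrat-stmt-Parity-13833-s2-0, 2026-08-17)

Nothing here is a route item or a registered stub. The file only certifies that the statements quoted in the
census ELABORATE over existing declarations (`lean check` rc 0, no `sorry`): the decomposition pieces
(`TypeIDivClasses`, `TypeIIDilationMeanSquare`, `DispersionTransfer`), the strengthenings
(`MobiusCofactorAtomPowerSaving`, `CofactorTypeII`), the transfer shadow (`MixedPairCore`) and the negation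
shape (`StrongSiegelZeros`, `NegationShape`), plus the two elementary identities the census leans on
(`cofactorSum_eq_sum_valueWeight`-type bookkeeping is NOT proved here; only definitions and `Iff.rfl`-level facts).
-/

namespace Summit.Parity.GeneralizedHardyLittlewood.Cruxes.MobiusCofactorAtom.Census

open Literature.NumberTheory.Sieve
open Summit.Parity.GeneralizedHardyLittlewood.Theses.ClassVarianceLadder (MobiusCofactorAtom)
open scoped BigOperators Classical

noncomputable section

/-! ### Objects (the crux's own summands, re-spelt through the value `r = ψ_{t+1}(n)`) -/

/-- The prime-tuple weight of the first `t` forms at `n`: `Π_{i ≤ t} Λ(ψ_i(n))`. -/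
def tupleWeight (t : ℕ) (Ψ : Fin (t + 1) → AffLinForm 1) (n : ℤ) : ℝ :=
  ∏ i : Fin t, intVonMangoldt ((Ψ (Fin.castSucc i)).eval fun _ => n)

/-- `w_Ψ(r; u, v) = Σ_{n ∈ [u,v], ψ_{t+1}(n) = r} Π_{i ≤ t} Λ(ψ_i(n))` — the tuple weight transported to the
VALUE `r` of the opened form (at most one `n` contributes, `ψ_{t+1}` being non-constant). -/
def valueWeight (t : ℕ) (Ψ : Fin (t + 1) → AffLinForm 1) (u v : ℤ) (r : ℕ) : ℝ :=
  ∑ n ∈ (Finset.Icc u v).filter (fun n : ℤ => (Ψ (Fin.last t)).eval (fun _ => n) = (r : ℤ)),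
    tupleWeight t Ψ n

/-- The crux's inner sum at dilation `m` (verbatim the route decl's inner sum; equal to
`Σ_{d ≥ 1} μ(d) · w_Ψ(m d; u, v)`). -/
def cofactorSum (t : ℕ) (Ψ : Fin (t + 1) → AffLinForm 1) (u v : ℤ) (m : ℕ) : ℝ :=
  ∑ n ∈ (Finset.Icc u v).filter (fun n : ℤ => 1 ≤ (Ψ (Fin.last t)).eval (fun _ => n) ∧
      (m : ℤ) ∣ (Ψ (Fin.last t)).eval (fun _ => n)),
    (ArithmeticFunction.moebius (((Ψ (Fin.last t)).eval (fun _ => n)).toNat / m) : ℝ) *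
      tupleWeight t Ψ n

/-- The atom over a set of dilations. -/
def atomSum (t : ℕ) (Ψ : Fin (t + 1) → AffLinForm 1) (u v : ℤ) (S : Finset ℕ) : ℝ :=
  ∑ m ∈ S, Real.log (m : ℝ) * |cofactorSum t Ψ u v m|

/-- The crux in this spelling (definitionally the route decl). -/
theorem mobiusCofactorAtom_iff :
    MobiusCofactorAtom ↔
      ∀ t : ℕ, 1 ≤ t → ∀ (L : ℕ) (A : ℝ), 0 < A → ∃ δ : ℝ, 0 < δ ∧ ∃ N₀ : ℕ, ∀ N : ℕ, N₀ ≤ N →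
        ∀ Ψ : Fin (t + 1) → AffLinForm 1, IsNondegenerateSystem Ψ → affLinSize Ψ N ≤ L →
          ∀ u v : ℤ, -(N : ℤ) ≤ u → v ≤ N →
            atomSum t Ψ u v (Finset.Icc 1 ⌊(N : ℝ) ^ δ⌋₊) ≤ (N : ℝ) / Real.log N ^ A :=
  Iff.rfl

/-! ### DECOMPOSITION (census §Decomposition): the Vaughan–dispersion split -/

/-- Tuple count of the first `t` forms in the divisibility class `{n : q ∣ ψ_{t+1}(n)}` (with `ψ_{t+1}(n) ≥ 1`). -/
def divClassCount (t : ℕ) (Ψ : Fin (t + 1) → AffLinForm 1) (u v : ℤ) (q : ℕ) : ℝ :=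
  ∑ n ∈ (Finset.Icc u v).filter (fun n : ℤ => 1 ≤ (Ψ (Fin.last t)).eval (fun _ => n) ∧
      (q : ℤ) ∣ (Ψ (Fin.last t)).eval (fun _ => n)), tupleWeight t Ψ n

/-- Relative density of the divisibility class among the `q`-admissible residues of the first `t` forms:
`ρ_Ψ(q) = #{r mod q : q ∣ ψ_{t+1}(r), (ψ_i(r), q) = 1 ∀ i ≤ t} / #{r mod q : (ψ_i(r), q) = 1 ∀ i ≤ t}`. -/
def relDensity (t : ℕ) (Ψ : Fin (t + 1) → AffLinForm 1) (q : ℕ) : ℝ :=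
  (((Finset.range q).filter fun r : ℕ =>
        (q : ℤ) ∣ (Ψ (Fin.last t)).eval (fun _ => (r : ℤ)) ∧
          ∀ i : Fin t, Int.gcd ((Ψ (Fin.castSucc i)).eval fun _ => (r : ℤ)) q = 1).card : ℝ) /
    (((Finset.range q).filter fun r : ℕ =>
        ∀ i : Fin t, Int.gcd ((Ψ (Fin.castSucc i)).eval fun _ => (r : ℤ)) q = 1).card : ℝ)

/-- **Type I piece** (= prime `t`-tuples of `(ψ_1,…,ψ_t)` are distributed among the divisibility classes
`{q ∣ ψ_{t+1}}` according to `ρ_Ψ(q)`, in `τ^B`-weighted `ℓ¹` over moduli `q ≤ N^{1/2−ε}` — the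
Bombieri–Vinogradov range; at `t = 1` this is Bombieri–Vinogradov with divisor weights, PROVABLE from the
tree's `bombieri_vinogradov_holds`; for `t ≥ 2` it is the Bombieri–Vinogradov range of the route's own
`TupleClassVariance`, Möbius-free and HL-free). -/
def TypeIDivClasses : Prop :=
  ∀ t : ℕ, 1 ≤ t → ∀ (L : ℕ) (A B ε : ℝ), 0 < A → 0 ≤ B → 0 < ε → ∃ N₀ : ℕ, ∀ N : ℕ, N₀ ≤ N →
    ∀ Ψ : Fin (t + 1) → AffLinForm 1, IsNondegenerateSystem Ψ → affLinSize Ψ N ≤ L →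
      ∀ u v : ℤ, -(N : ℤ) ≤ u → v ≤ N →
        ∑ q ∈ Finset.Icc 1 ⌊(N : ℝ) ^ (1 / 2 - ε)⌋₊,
            ((Nat.divisors q).card : ℝ) ^ B *
              |divClassCount t Ψ u v q - relDensity t Ψ q * divClassCount t Ψ u v 1| ≤
          (N : ℝ) / Real.log N ^ A

/-- A dyadic Möbius-twisted piece of the inner sum at dilation `q`: `Σ_{B < b ≤ 2B} μ(b) w_Ψ(q b; u, v)`. -/
def muTwistedPiece (t : ℕ) (Ψ : Fin (t + 1) → AffLinForm 1) (u v : ℤ) (q : ℕ) (B : ℝ) : ℝ :=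
  ∑ b ∈ Finset.Ioc ⌊B⌋₊ ⌊2 * B⌋₊, (ArithmeticFunction.moebius b : ℝ) * valueWeight t Ψ u v (q * b)

/-- **Type II piece, dispersed form** (= the MEAN SQUARE over the dilations `q = m c`, `c ∼ C`, of the dyadic
Möbius-twisted pieces, for all `C, B ≥ N^θ` with some `θ < 1/6` and every base dilation `m ≥ 1` (any exponent below `1/4`
serves `DispersionTransfer`; below `1/6` the same statement also serves `SplitDecidesSummit`): "`μ` of the
cofactor shows log-power cancellation against the tuple weight for ALMOST ALL dilations in every dilated dyadic
family, in `L²`"; the trivial bound is `C B² (log N)^{2t}` for every `m`, so the demand is a pure log-power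
saving). This is where ALL the difficulty of the crux goes under the split (census §Decomposition: together with
`TypeIDivClasses` it even yields the quantitative Hardy–Littlewood step `Q_t → Q_{t+1}` directly — summit
strength). -/
def TypeIIDilationMeanSquare : Prop :=
  ∃ θ : ℝ, 0 < θ ∧ θ < 1 / 6 ∧
    ∀ t : ℕ, 1 ≤ t → ∀ (L : ℕ) (A : ℝ), 0 < A → ∃ N₀ : ℕ, ∀ N : ℕ, N₀ ≤ N →
      ∀ Ψ : Fin (t + 1) → AffLinForm 1, IsNondegenerateSystem Ψ → affLinSize Ψ N ≤ L →
        ∀ u v : ℤ, -(N : ℤ) ≤ u → v ≤ N → ∀ m : ℕ, 1 ≤ m →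
          ∀ C B : ℝ, (N : ℝ) ^ θ ≤ C → (N : ℝ) ^ θ ≤ B →
            ∑ c ∈ Finset.Ioc ⌊C⌋₊ ⌊2 * C⌋₊, muTwistedPiece t Ψ u v (m * c) B ^ 2 ≤
              C * B ^ 2 / Real.log N ^ A

/-- **Transfer (bookkeeping) piece**: Vaughan's identity on `μ(d)` with `U = N^{θ'}`, `θ ≤ θ' < 1/4 − δ`,
Type I main terms by Möbius cancellation against `ρ_Ψ` (PNT-rate twisted Möbius sums, tree:
`SiegelWalfiszMoebius_holds`), Cauchy–Schwarz over the un-structured variable, dyadic bookkeeping.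
PROVABLE in principle (Linnik–Vinogradov bookkeeping, est. XL in Lean); it is the glue of the split. -/
def DispersionTransfer : Prop :=
  TypeIDivClasses → TypeIIDilationMeanSquare → MobiusCofactorAtom

/-- The split composes (trivially — the content is in the three pieces). -/
theorem MobiusCofactorAtom_of_split (hT : DispersionTransfer) (hI : TypeIDivClasses)
    (hII : TypeIIDilationMeanSquare) : MobiusCofactorAtom :=
  hT hI hII

/-- **Why the split is not filed** (census §Decomposition): its two substantive pieces already DECIDE the
sub-problem — the Bombieri opening `Λ = μ ⋆ log` of the last form, with Cauchy–Schwarz on the COFACTOR (keeping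
`μ`) instead of on the modulus, turns `Q_t → Q_{t+1}` into `TypeIDivClasses` (the `d ≤ N^θ` range), the
mean square `TypeIIDilationMeanSquare` (the range `N^θ < d`, `N^θ < ψ_{t+1}(n)/d`) and the atom for dilations
`≤ N^θ`, itself implied by the two pieces; with `LadderBase` (`Q_1`, provable) and `QuantToGHL` (provable)
this is the whole summit. Stated as a `Prop`; the bookkeeping is Linnik–Vinogradov routine (not written). -/
def SplitDecidesSummit : Prop :=
  TypeIDivClasses → TypeIIDilationMeanSquare →
    Summit.Parity.GeneralizedHardyLittlewood.Theses.ClassVarianceLadder.LadderBase →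
      Summit.Parity.GeneralizedHardyLittlewood.Theses.ClassVarianceLadder.QuantToGHL →
        _root_.GeneralizedHardyLittlewood

/-! ### STRENGTHEN (census §Strengthen) -/

/-- `S⁺₁`: power saving in place of every log power (GRH-shape). -/
def MobiusCofactorAtomPowerSaving : Prop :=
  ∀ t : ℕ, 1 ≤ t → ∀ L : ℕ, ∃ δ : ℝ, 0 < δ ∧ ∃ η : ℝ, 0 < η ∧ ∃ N₀ : ℕ, ∀ N : ℕ, N₀ ≤ N →
    ∀ Ψ : Fin (t + 1) → AffLinForm 1, IsNondegenerateSystem Ψ → affLinSize Ψ N ≤ L →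
      ∀ u v : ℤ, -(N : ℤ) ≤ u → v ≤ N →
        atomSum t Ψ u v (Finset.Icc 1 ⌊(N : ℝ) ^ δ⌋₊) ≤ (N : ℝ) ^ (1 - η)

/-- The power-saving form implies the crux (monotonicity: `N^{1-η} ≤ N/(log N)^A` eventually) — recorded as a
statement only; the census point is that the added rigidity exposes no new tool. -/
def PowerSavingImpliesAtom : Prop := MobiusCofactorAtomPowerSaving → MobiusCofactorAtom

/-- `S⁺₂` (**Type II information for the values of the opened form at prime `t`-tuples**): the dispersed
Type II bound for EVERY `1`-bounded coefficient sequence `β` on `(B, 2B]` obeying a Siegel–Walfisz condition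
to polylog moduli, in place of `μ`. This is the Polymath8b §8 "bilinear axiom" / the Friedlander–Iwaniec
asymptotic-sieve hypothesis (B) for the sequence of `ψ_{t+1}`-values at prime tuples; census: at `t = 1`,
together with Bombieri–Vinogradov it yields Hardy–Littlewood for PAIRS with log-power error (Vinogradov's
method applied to `Λ` consumes exactly these inputs), so it is summit-strength at `t + 1 = 2`. -/
def CofactorTypeII : Prop :=
  ∃ θ : ℝ, 0 < θ ∧ θ < 1 / 6 ∧
    ∀ t : ℕ, 1 ≤ t → ∀ (L : ℕ) (A : ℝ), 0 < A → ∃ A' E : ℝ, ∃ N₀ : ℕ, ∀ N : ℕ, N₀ ≤ N →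
      ∀ Ψ : Fin (t + 1) → AffLinForm 1, IsNondegenerateSystem Ψ → affLinSize Ψ N ≤ L →
        ∀ u v : ℤ, -(N : ℤ) ≤ u → v ≤ N → ∀ m : ℕ, 1 ≤ m →
          ∀ C B : ℝ, (N : ℝ) ^ θ ≤ C → (N : ℝ) ^ θ ≤ B →
          ∀ β : ℕ → ℝ, (∀ b, |β b| ≤ (Nat.divisors b).card) →
            (∀ q₀ a : ℕ, 1 ≤ q₀ → (q₀ : ℝ) ≤ Real.log N ^ E →
              |∑ b ∈ (Finset.Ioc ⌊B⌋₊ ⌊2 * B⌋₊).filter (fun b : ℕ => b % q₀ = a % q₀), β b| ≤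
                B / Real.log N ^ A') →
            ∑ c ∈ Finset.Ioc ⌊C⌋₊ ⌊2 * C⌋₊,
                (∑ b ∈ Finset.Ioc ⌊B⌋₊ ⌊2 * B⌋₊, β b * valueWeight t Ψ u v (m * c * b)) ^ 2 ≤
              C * B ^ 2 / Real.log N ^ A

/-! ### TRANSFER shadow (census §Transfer, sibling route DeterminantMoebiusCores): the mixed pair core -/

/-- `Λ♯_P(r) = Σ_{d ∣ r, d > P} μ(d) log(r/d)` for `r ≥ 1`, `0` for `r ≤ 0` (the sibling route's core object, inlined). -/
def lambdaSharp (P : ℝ) (r : ℤ) : ℝ :=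
  if r ≤ 0 then 0
  else ∑ d ∈ (Nat.divisors r.toNat).filter (fun d : ℕ => P < (d : ℝ)),
      (ArithmeticFunction.moebius d : ℝ) * Real.log ((r : ℝ) / d)

/-- `T₁`: the MIXED two-point core met when the remaining factor of the `t = 1` atom is opened as
`Λ = Λ♭_P + Λ♯_P`: `Σ_{n ∈ [u,v], m ∣ ψ₂(n) ≥ 1} μ(ψ₂(n)/m) Λ♯_P(ψ₁(n))` has log-power cancellation for
`P = N^θ`, pointwise in the dilation `m ≤ N^δ`. The all-`♭` companion term is Möbius in progressions to moduli
`≤ m N^θ` (Bombieri–Vinogradov for `μ`, provable), so `T₁(m)` is EQUIVALENT to the pointwise atom bound at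
`m` — the species of `DeterminantMoebiusCores.PairCores` with one `Λ♯` slot replaced by a bare dilated `μ`. -/
def MixedPairCore : Prop :=
  ∀ (L : ℕ) (A θ : ℝ), 0 < A → 0 < θ → θ < 1 / 2 → ∃ δ : ℝ, 0 < δ ∧ ∃ N₀ : ℕ, ∀ N : ℕ, N₀ ≤ N →
    ∀ Ψ : Fin 2 → AffLinForm 1, IsNondegenerateSystem Ψ → affLinSize Ψ N ≤ L →
      ∀ u v : ℤ, -(N : ℤ) ≤ u → v ≤ N → ∀ m : ℕ, 2 ≤ m → (m : ℝ) ≤ (N : ℝ) ^ δ →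
        |∑ n ∈ (Finset.Icc u v).filter (fun n : ℤ => 1 ≤ (Ψ 1).eval (fun _ => n) ∧
              (m : ℤ) ∣ (Ψ 1).eval (fun _ => n)),
            (ArithmeticFunction.moebius (((Ψ 1).eval (fun _ => n)).toNat / m) : ℝ) *
              lambdaSharp ((N : ℝ) ^ θ) ((Ψ 0).eval fun _ => n)| ≤
          (N : ℝ) / Real.log N ^ A

/-! ### NEGATION shape (census §Negation) -/

/-- Exceptional zeros with unbounded quality `η`: for every `η ≥ 10` some primitive quadratic character `χ`
mod `q ≥ 3` has `L(1 − 1/(η log q), χ) = 0` (the hypothesis of `MatomakiMerikoski2023_pairCorrelation`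
available at every `η`; negation of a quantitative form of `Literature.NumberTheory.LFunctions.NoSiegelZeros`). -/
def StrongSiegelZeros : Prop :=
  ∀ η : ℝ, 10 ≤ η → ∃ (q : ℕ) (_ : NeZero q), 3 ≤ q ∧
    ∃ χ : DirichletCharacter ℂ q, χ.IsPrimitive ∧ χ.IsQuadratic ∧
      χ.LFunction ((1 - 1 / (η * Real.log q) : ℝ) : ℂ) = 0

/-- The only counterexample mechanism found: in the illusory world the atom FAILS at shifts `h ≡ 0 (mod q)`
(`μ ≈ μ²·χ` on the cofactor makes `S_Ψ(m)` a biased prime sum of size `≍ N/φ(m)`), so any proof of the crux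
is also a proof of a zero-repulsion theorem — an obstruction inherited from the summit (uniform
Hardy–Littlewood itself fails there: `MatomakiMerikoski2023_pairCorrelation`, correction factor `2` at `h = q`). -/
def NegationShape : Prop := StrongSiegelZeros → ¬ MobiusCofactorAtom

end

end Summit.Parity.GeneralizedHardyLittlewood.Cruxes.MobiusCofactorAtom.Census
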